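import Literature.NumberTheory.LFunctions.ConreyIwaniec2002FloorClose
import Literature.NumberTheory.LFunctions.ConreyIwaniec2002Prop91Unrestricted
import HarnessLib

/-!
# Conrey–Iwaniec (2002), Proposition 9.1 for ARBITRARY companions ABOVE THE FLOOR `q^{65}`

B. Conrey, H. Iwaniec, *Spacing of zeros of Hecke L-functions and the class number problem*,
Acta Arith. 103 (2002), §§7–9 [held text `paper:arxiv-math_0111012`, p0017–p0020]: Proposition 9.1
(9.7), companions (8.4) unrestricted.

The tree proves (9.7) with arbitrary companions from Proposition 6.4 (binder `h64`) in the range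
`2q^{66} ≤ T`, `2e^{(log q)²} ≤ T` (`prop91_unrestricted_of_proposition64`): the windows `(T/2, T]`
of the maximisers of companions below `T` need the discrete mean square of `L` at level `T/2`.
THIS FILE proves (9.7) with arbitrary companions at every level `T ≥ q^{65}` with `e^{(log q)²} ≤ T`
for `1`-spaced `S ⊂ (T, 2T]` all of whose points lie above `q^{65} + 2q + 2`
(`prop91_floor_of_proposition64`):
* close companions: `prop91_floor_close_of_proposition64` (`ConreyIwaniec2002FloorClose`);
* the discrete mean square of `L` above the floor (`sum_norm_classGroupLFunction_sq_floor`, from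
  `main_meanSquares'` (ii)), at the levels `max(T/2, q^{65})`, `T`, `2T` — all `≥ q^{65}`;
* far companions `1 < |t′ − t| ≤ T/4` with `t′ ≥ q^{65} + q + 1`: the tree's maximiser trick
  (`far_sum_le_sup_sum`, `sum_sup_le`) applied to the TRUNCATED function
  `F′(v) = 𝟙_{v ≥ q^{65}+q}|L(½+iv)|²` (maximisers by `exists_max_trunc`), so that the window
  hypotheses only ever see point sets above `q^{65} + q`;
* far companions with `t′ < q^{65} + q + 1`: then `T < 2q^{65}`, `log T ≤ 66 log q`, the points of
  `S` are at distance `> q` from such companions (`Σ_t (t − t′)^{-2} ≤ 8/(q+1)` by the Poisson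
  density), and the convexity-strength bound `|L(½+iu)|² ≪ qT(log T)^5`
  (`norm_afeA_sq_le_conv`) suffices;
* remote companions `|t′ − t| > T/4`: the tree's hypothesis-free `norm_sq_le_sq_dist_of_remote`.
Cell landau-siegel / ls-inputs, I6b (binder range `q^{65} ≤ T` of SKELETON I6, S1). Everything
PROVED; no definition.

«The programme SEARCHES and TYPES; no claim about Landau–Siegel zeros until a kernel theorem says so.»

## References
* [ConreyIwaniec2002] B. Conrey, H. Iwaniec, Acta Arith. 103 (2002) 259–312, arXiv:math/0111012:
  Proposition 7.1 (7.12), (7.19)–(7.20), §8 (8.1)–(8.4), (8.10), §9 (9.1), (9.6), Proposition 9.1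
  (9.7); Lemma 5.3 (5.11)–(5.12).
-/

noncomputable section

open scoped NumberField ComplexConjugate
open Complex

namespace Literature.NumberTheory.LFunctions

namespace ConreyIwaniec2002

open NumberField

/-! ### §1. The discrete mean square of `L(½+it,ψ)` above the floor -/

/-- **THE DISCRETE MEAN SQUARE OF `L(½+it,ψ)` ABOVE THE FLOOR, FROM PROPOSITION 6.4.**
For `q` odd `> 4`, `K = ℚ(√−q)`, `ψ ∈ Ĉℓ(K)`, `1`-spaced `S ⊂ (T, 2T]` with every point
`≥ q^65 + q`, `q^65 ≤ T`: `Σ_{t∈S} |L(½+it,ψ)|² ≤ C·(T(log q)^7 + Tℒ(T)(log T)^4)` — the tree's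
`sum_norm_classGroupLFunction_sq_le` with `main_meanSquares'` (ii) for `main_meanSquares` (ii).
[cite: ConreyIwaniec2002, §8 (8.7)–(8.10); Proposition 7.1 (7.12)] -/
theorem sum_norm_classGroupLFunction_sq_floor (h64 : conreyIwaniec2002_proposition64) :
    ∃ C : ℝ, 0 < C ∧
    ∀ (q : ℕ) [NeZero q], 4 < q → Odd q → ∀ χ : DirichletCharacter ℂ q,
      χ.IsPrimitive → χ.IsQuadratic → χ.Odd →
        ∀ (K : Type) [Field K] [NumberField K],
          Module.finrank ℚ K = 2 → NumberField.discr K = -(q : ℤ) →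
            ∀ (ψ : ClassGroup (𝓞 K) →* ℂˣ) (T : ℝ) (S : Finset ℝ),
              (q : ℝ) ^ (65 : ℕ) ≤ T → IsDyadicPointSet S T → (∀ t ∈ S, (q : ℝ) ^ (65 : ℕ) + q ≤ t) →
                ∑ t ∈ S, ‖classGroupLFunction K ψ (1 / 2 + t * I)‖ ^ 2 ≤
                  C * (T * Real.log q ^ (7 : ℕ) + T * calL χ T * Real.log T ^ (4 : ℕ)) := by
  obtain ⟨C₁, hC₁, hMS⟩ := main_meanSquares' h64 divisorSq_weighted_tsum_le
  obtain ⟨C₂, hC₂, hN⟩ := sum_norm_shortLSum_sq_le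
  obtain ⟨M, hM, hR⟩ := norm_afeR_half_le
  refine ⟨12 * C₁ + 12 * C₂ + 6 * M ^ 2, by positivity,
    fun q _ hq hodd χ hprim hquad hoddχ K _ _ h2 hdisc ψ T S hT hS hfloor => ?_⟩
  have hq0 : 0 < q := by omega
  obtain ⟨hℓ1, -, hLT1, -, hq41, -, hT3, -, -, -, -, hq_le_T⟩ := prop81_numerics65 hq hT
  have hT0 : 0 < T := by linarith
  have hq4T : (q : ℝ) ^ (4 : ℕ) ≤ T := by
    have : ((q ^ 4 : ℕ) : ℝ) = (q : ℝ) ^ (4 : ℕ) := by push_cast; ring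
    linarith
  have hcalL0 : 0 ≤ calL χ T := calL_nonneg χ (by linarith)
  set X : ℝ := T * Real.log q ^ (7 : ℕ) + T * calL χ T * Real.log T ^ (4 : ℕ) with hX
  -- (ii) of `main_meanSquares'` with the dummy companions `t ↦ t + 1/2`
  have hii := (hMS q hq hodd χ hprim hquad hoddχ K h2 hdisc ψ T S (fun t => t + 1 / 2) hT hS hfloor
    (fun t _ => ⟨by linarith, by
      rw [show t + 1 / 2 - t = (1 / 2 : ℝ) by ring, abs_of_pos (by norm_num)]; norm_num⟩)).2
  have hAN : ∑ t ∈ S, ‖afeA K ψ q (1 / 2 + t * I) - shortLSum K ψ q (1 / 2 + t * I)‖ ^ 2 ≤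
      C₁ * X := by
    have h0 : 0 ≤ ∑ t ∈ S, ‖afeA K ψ q (1 / 2 + t * I) - shortLSum K ψ q (1 / 2 + t * I)‖ ^ 2 :=
      Finset.sum_nonneg fun _ _ => by positivity
    have h1 : (1 : ℝ) ≤ Real.log T ^ (2 : ℕ) := one_le_pow₀ hLT1
    calc ∑ t ∈ S, ‖afeA K ψ q (1 / 2 + t * I) - shortLSum K ψ q (1 / 2 + t * I)‖ ^ 2
        = 1 * ∑ t ∈ S, ‖afeA K ψ q (1 / 2 + t * I) - shortLSum K ψ q (1 / 2 + t * I)‖ ^ 2 :=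
          (one_mul _).symm
      _ ≤ Real.log T ^ (2 : ℕ) *
            ∑ t ∈ S, ‖afeA K ψ q (1 / 2 + t * I) - shortLSum K ψ q (1 / 2 + t * I)‖ ^ 2 :=
          mul_le_mul_of_nonneg_right h1 h0
      _ ≤ C₁ * X := hii
  -- the mean square of `N`
  have hNN := hN q hq hodd χ hprim hquad hoddχ K h2 hdisc ψ T S hq4T hS
  -- pointwise `|L|² ≤ 12|A − N|² + 12|N|² + 3M²`
  have hpt : ∀ t ∈ S, ‖classGroupLFunction K ψ (1 / 2 + t * I)‖ ^ 2 ≤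
      12 * ‖afeA K ψ q (1 / 2 + t * I) - shortLSum K ψ q (1 / 2 + t * I)‖ ^ 2 +
        12 * ‖shortLSum K ψ q (1 / 2 + t * I)‖ ^ 2 + 3 * M ^ 2 := by
    intro t ht
    obtain ⟨hTt, -⟩ := hS.mem_bounds ht
    have hq5 : (5 : ℝ) ≤ q := by exact_mod_cast hq
    have h625 : (5 : ℝ) ^ (4 : ℕ) ≤ (q : ℝ) ^ (4 : ℕ) := pow_le_pow_left₀ (by norm_num) hq5 4
    have ht4 : 4 ≤ |t| := by rw [abs_of_pos (by linarith)]; norm_num at h625; linarith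
    have htq : (q : ℝ) + 1 ≤ |t| := by
      rw [abs_of_pos (by linarith)]
      have : (q : ℝ) ≤ (q : ℝ) ^ (4 : ℕ) := le_self_pow₀ (by linarith) (by norm_num)
      have h' : ((q ^ 4 : ℕ) : ℝ) = (q : ℝ) ^ (4 : ℕ) := by push_cast; ring
      linarith
    have hL := norm_classGroupLFunction_le_afe hq0 K h2 hdisc ψ t
    have hRt := hR q hq0 K h2 hdisc ψ t htq ht4
    set A := afeA K ψ q (1 / 2 + t * I) with hA
    set Nn := shortLSum K ψ q (1 / 2 + t * I) with hNn
    have hAle : ‖A‖ ≤ ‖A - Nn‖ + ‖Nn‖ := by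
      calc ‖A‖ = ‖(A - Nn) + Nn‖ := by rw [sub_add_cancel]
        _ ≤ ‖A - Nn‖ + ‖Nn‖ := norm_add_le _ _
    have hLle : ‖classGroupLFunction K ψ (1 / 2 + t * I)‖ ≤ 2 * ‖A - Nn‖ + 2 * ‖Nn‖ + M := by
      linarith
    have h0 : 0 ≤ ‖classGroupLFunction K ψ (1 / 2 + t * I)‖ := norm_nonneg _
    have h1 : 0 ≤ ‖A - Nn‖ := norm_nonneg _
    have h2' : 0 ≤ ‖Nn‖ := norm_nonneg _
    calc ‖classGroupLFunction K ψ (1 / 2 + t * I)‖ ^ 2 ≤ (2 * ‖A - Nn‖ + 2 * ‖Nn‖ + M) ^ 2 :=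
          pow_le_pow_left₀ h0 hLle 2
      _ ≤ 12 * ‖A - Nn‖ ^ 2 + 12 * ‖Nn‖ ^ 2 + 3 * M ^ 2 := by
          nlinarith [sq_nonneg (‖A - Nn‖ - ‖Nn‖), sq_nonneg (2 * ‖Nn‖ - M),
            sq_nonneg (2 * ‖A - Nn‖ - M)]
  -- the number of points
  have hT2 : (2 : ℝ) ≤ T := by linarith
  have hcard : (S.card : ℝ) ≤ 2 * T := (hS.isPointSet hT2).card_le' (by linarith)
  -- lower-order terms against `X`
  have hX1 : T * Real.log q ^ (5 : ℕ) ≤ X := by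
    have h57 : Real.log q ^ (5 : ℕ) ≤ Real.log q ^ (7 : ℕ) := pow_le_pow_right₀ hℓ1 (by norm_num)
    have : 0 ≤ T * calL χ T * Real.log T ^ (4 : ℕ) := by positivity
    rw [hX]; nlinarith
  have hX2 : T ≤ X := by
    have h7 : (1 : ℝ) ≤ Real.log q ^ (7 : ℕ) := one_le_pow₀ hℓ1
    have : 0 ≤ T * calL χ T * Real.log T ^ (4 : ℕ) := by positivity
    rw [hX]; nlinarith
  calc ∑ t ∈ S, ‖classGroupLFunction K ψ (1 / 2 + t * I)‖ ^ 2
      ≤ ∑ t ∈ S, (12 * ‖afeA K ψ q (1 / 2 + t * I) - shortLSum K ψ q (1 / 2 + t * I)‖ ^ 2 +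
          12 * ‖shortLSum K ψ q (1 / 2 + t * I)‖ ^ 2 + 3 * M ^ 2) := Finset.sum_le_sum hpt
    _ = 12 * ∑ t ∈ S, ‖afeA K ψ q (1 / 2 + t * I) - shortLSum K ψ q (1 / 2 + t * I)‖ ^ 2 +
          12 * ∑ t ∈ S, ‖shortLSum K ψ q (1 / 2 + t * I)‖ ^ 2 + 3 * M ^ 2 * S.card := by
        rw [Finset.sum_add_distrib, Finset.sum_add_distrib, Finset.sum_const, nsmul_eq_mul,
          ← Finset.mul_sum, ← Finset.mul_sum]
        ring
    _ ≤ 12 * (C₁ * X) + 12 * (C₂ * (T * Real.log q ^ (5 : ℕ))) + 3 * M ^ 2 * (2 * T) := by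
        gcongr
    _ ≤ 12 * (C₁ * X) + 12 * (C₂ * X) + 3 * M ^ 2 * (2 * X) := by
        have hM2 : 0 ≤ 3 * M ^ 2 := by positivity
        nlinarith [mul_le_mul_of_nonneg_left hX1 hC₂.le, mul_le_mul_of_nonneg_left hX2 hM2]
    _ = (12 * C₁ + 12 * C₂ + 6 * M ^ 2) * X := by ring

/-! ### §2. Maximisers of a truncated non-negative continuous function on unit intervals -/

/-- **Maximisers of `𝟙_{v ≥ c}·g(v)` on `[k, k+1]`** for a continuous `g ≥ 0`: the truncated function
attains its maximum (on `[max(k,c), k+1]` if `c ≤ k+1`, trivially otherwise). This lets the tree's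
maximiser trick (`far_sum_le_sup_sum`, `sum_sup_le`) run with `F′ = 𝟙_{v ≥ q^65+q}|L(½+iv)|²`, whose
window sums only see point sets above the floor. [cite: ConreyIwaniec2002, §9 (9.1), (9.6)] -/
theorem exists_max_trunc (g : ℝ → ℝ) (hg : Continuous g) (hg0 : ∀ v, 0 ≤ g v) (c : ℝ) (k : ℤ) :
    ∃ u : ℝ, (k : ℝ) ≤ u ∧ u ≤ k + 1 ∧ ∀ v : ℝ, (k : ℝ) ≤ v → v ≤ k + 1 →
      (if c ≤ v then g v else 0) ≤ (if c ≤ u then g u else 0) := by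
  by_cases hc : c ≤ (k : ℝ) + 1
  · have hne : (Set.Icc (max (k : ℝ) c) (k + 1)).Nonempty :=
      Set.nonempty_Icc.2 (max_le (by linarith) hc)
    obtain ⟨u, hu, hmax⟩ := isCompact_Icc.exists_isMaxOn hne (hg.continuousOn)
    have hku : (k : ℝ) ≤ u := le_trans (le_max_left _ _) hu.1
    have hcu : c ≤ u := le_trans (le_max_right _ _) hu.1
    refine ⟨u, hku, hu.2, fun v hv1 hv2 => ?_⟩
    rw [if_pos hcu]
    by_cases hcv : c ≤ v
    · rw [if_pos hcv]
      exact (isMaxOn_iff.mp hmax) v ⟨max_le hv1 hcv, hv2⟩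
    · rw [if_neg hcv]; exact hg0 u
  · push Not at hc
    refine ⟨k, le_rfl, by linarith, fun v hv1 hv2 => ?_⟩
    have h1 : ¬ c ≤ v := by push Not; linarith
    have h2 : ¬ c ≤ (k : ℝ) := by push Not; linarith
    rw [if_neg h1, if_neg h2]

/-- `v ↦ |L(½+iv,ψ)|²` is continuous and non-negative. [cite: ConreyIwaniec2002, §9 (9.1)] -/
theorem continuous_norm_sq_classGroupLFunction_line {K : Type} [Field K] [NumberField K]
    (ψ : ClassGroup (𝓞 K) →* ℂˣ) :
    Continuous fun v : ℝ => ‖classGroupLFunction K ψ (1 / 2 + v * I)‖ ^ 2 := by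
  have hg : Continuous fun v : ℝ => (1 / 2 : ℂ) + (v : ℂ) * I :=
    continuous_const.add (Complex.continuous_ofReal.mul continuous_const)
  have hcomp : Continuous (classGroupLFunction K ψ ∘ fun v : ℝ => (1 / 2 : ℂ) + (v : ℂ) * I) := by
    refine continuous_iff_continuousAt.2 fun v => ?_
    have hs : (1 / 2 : ℂ) + (v : ℂ) * I ≠ 1 := by
      intro e
      have := congrArg Complex.re e
      norm_num at this
    exact ContinuousAt.comp (f := fun v : ℝ => (1 / 2 : ℂ) + (v : ℂ) * I) (x := v)
      (differentiableAt_classGroupLFunction ψ hs).continuousAt hg.continuousAt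
  exact hcomp.norm.pow 2

/-! ### §3. Points at distance `≥ d` above a fixed height -/

/-- **`Σ_{t ∈ P} (t − c)^{−2} ≤ 8/d`** for a `1`-spaced finite `P ⊂ [c + d, ∞)`, `d ≥ 1`: each term is
`≤ 2(1 + (c − t)²)^{−1}` and the Poisson density of `P` at `c` is `≤ 4/d` (tree
`sum_inv_one_add_sq_le` and the arctangent tail `intervalIntegral_inv_one_add_sq_le_inv`).
[cite: ConreyIwaniec2002, §5 (5.11)–(5.12)] -/
theorem sum_inv_sq_sub_le_of_floor (P : Finset ℝ) {c d : ℝ} (hd : 1 ≤ d)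
    (hP : ∀ t ∈ P, c + d ≤ t) (hsep : ∀ t ∈ P, ∀ u ∈ P, t ≠ u → (1 : ℝ) ≤ |t - u|) :
    ∑ t ∈ P, ((t - c) ^ 2)⁻¹ ≤ 8 / d := by
  classical
  have hd0 : 0 < d := by linarith
  rcases P.eq_empty_or_nonempty with h0 | hne
  · rw [h0, Finset.sum_empty]; positivity
  obtain ⟨m, hm⟩ := Finset.max_of_nonempty hne
  have hmP : m ∈ P := Finset.mem_of_max hm
  have hle : ∀ t ∈ P, t ≤ m := fun t ht => Finset.le_max_of_eq ht hm
  have hX : c + d ≤ m := hP m hmP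
  -- each term against the Poisson weight at `c`
  have hpt : ∀ t ∈ P, ((t - c) ^ 2)⁻¹ ≤ 2 * (1 + (c - t) ^ 2)⁻¹ := by
    intro t ht
    have htc : 1 ≤ t - c := by linarith [hP t ht]
    have h1 : 1 ≤ (t - c) ^ 2 := by nlinarith
    have hpos : 0 < 1 + (c - t) ^ 2 := by positivity
    have h2 : 1 + (c - t) ^ 2 ≤ 2 * (t - c) ^ 2 := by nlinarith
    have h3 : (2 * (t - c) ^ 2)⁻¹ ≤ (1 + (c - t) ^ 2)⁻¹ := inv_anti₀ hpos h2
    calc ((t - c) ^ 2)⁻¹ = 2 * (2 * (t - c) ^ 2)⁻¹ := by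
          rw [mul_inv, ← mul_assoc, mul_inv_cancel₀ (two_ne_zero), one_mul]
      _ ≤ 2 * (1 + (c - t) ^ 2)⁻¹ := by linarith
  -- the Poisson density of `P` at `c`
  have hdens := WeightedMeanValue.sum_inv_one_add_sq_le one_pos le_rfl P (X₁ := c + d) (X₂ := m) hX
    (fun t ht => ⟨hP t ht, hle t ht⟩) hsep c
  have htail : ∫ u in (c + d - 1 / 2)..(m + 1 / 2), (1 + (c - u) ^ 2)⁻¹ ≤ 1 / (d / 2) :=
    WeightedMeanValue.intervalIntegral_inv_one_add_sq_le_inv (by positivity) (by linarith)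
  calc ∑ t ∈ P, ((t - c) ^ 2)⁻¹ ≤ ∑ t ∈ P, 2 * (1 + (c - t) ^ 2)⁻¹ := Finset.sum_le_sum hpt
    _ = 2 * ∑ t ∈ P, (1 + (c - t) ^ 2)⁻¹ := by rw [Finset.mul_sum]
    _ ≤ 2 * ((2 / 1) * ∫ u in (c + d - 1 / 2)..(m + 1 / 2), (1 + (c - u) ^ 2)⁻¹) :=
        mul_le_mul_of_nonneg_left hdens (by norm_num)
    _ ≤ 2 * ((2 / 1) * (1 / (d / 2))) := by gcongr
    _ = 8 / d := by field_simp; ring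

/-! ### §4. A convexity-strength bound for `|L(½+iu,ψ)|²` at heights `≍ T` -/

/-- **`|L(½+iu,ψ)|² ≤ C·qT(log T)^5` for `q + 1 ≤ |u|`, `4 ≤ |u|, `|u| ≤ 2T + 1`, `q ≤ T`, `T ≥ 3`**
(`|L| ≤ 2|A| + |R|`, the convexity-strength bound `norm_afeA_sq_le_conv` for `|A|²` with
`Q(|u| + ½) + 2 ≤ 2qT`, `|R| ≤ M`). [cite: ConreyIwaniec2002, Proposition 7.1 (7.12), Lemma 7.2 (7.16)] -/
theorem norm_sq_classGroupLFunction_le_conv :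
    ∃ C : ℝ, 0 < C ∧
    ∀ (q : ℕ) [NeZero q], 4 < q → ∀ χ : DirichletCharacter ℂ q,
      χ.IsPrimitive → χ.IsQuadratic → χ.Odd →
        ∀ (K : Type) [Field K] [NumberField K],
          Module.finrank ℚ K = 2 → NumberField.discr K = -(q : ℤ) →
            ∀ (ψ : ClassGroup (𝓞 K) →* ℂˣ) (T u : ℝ),
              3 ≤ T → (q : ℝ) ≤ T → condQ q * (2 * T + 2) ≤ q * T →
              (q : ℝ) + 1 ≤ |u| → 4 ≤ |u| → |u| ≤ 2 * T + 1 →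
                ‖classGroupLFunction K ψ (1 / 2 + u * I)‖ ^ 2 ≤
                  C * ((q : ℝ) * T * Real.log T ^ 5) := by
  obtain ⟨CA, hCA, hA⟩ := norm_afeA_sq_le_conv
  obtain ⟨M, hM, hR⟩ := norm_afeR_half_le
  refine ⟨8 * (2 * 4 ^ 4 * 6) * CA + 2 * M ^ 2, by positivity,
    fun q _ hq χ hprim hquad hoddχ K _ _ h2 hdisc ψ T u hT3 hqT hQT hqu h4u hu2T => ?_⟩
  have hq0 : 0 < q := by omega
  have hq5 : (5 : ℝ) ≤ q := by exact_mod_cast hq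
  have hqpos : (0 : ℝ) < q := by linarith
  have hT0 : 0 < T := by linarith
  have hT1 : 1 < T := by linarith
  have hlogT : 1 ≤ Real.log T := by
    rw [Real.le_log_iff_exp_le hT0]; exact Real.exp_one_lt_d9.le.trans (by linarith)
  have hlogq : Real.log q ≤ Real.log T := Real.log_le_log hqpos hqT
  have hu1 : 1 ≤ |u| := by linarith
  have hAu := hA q hq χ hprim hquad hoddχ K h2 hdisc ψ u hu1
  have hRu := hR q hq0 K h2 hdisc ψ u hqu h4u
  have hLu := norm_classGroupLFunction_le_afe hq0 K h2 hdisc ψ u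
  -- `Y₂ = Q‖½+iu‖ + 2 ≤ 2qT`
  set Y₂ : ℝ := condQ q * ‖(1 / 2 : ℂ) + u * I‖ + 2 with hY₂
  have hQ0 : 0 < condQ q := condQ_pos hq0
  have hnorm : ‖(1 / 2 : ℂ) + u * I‖ ≤ 2 * T + 2 := by
    calc ‖(1 / 2 : ℂ) + u * I‖ ≤ ‖(1 / 2 : ℂ)‖ + ‖(u : ℂ) * I‖ := norm_add_le _ _
      _ = 1 / 2 + |u| := by
          rw [norm_mul, Complex.norm_I, mul_one, Complex.norm_real, Real.norm_eq_abs]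
          norm_num
      _ ≤ 2 * T + 2 := by linarith
  have hY2T : Y₂ ≤ 2 * (q * T) := by
    have h1 : condQ q * ‖(1 / 2 : ℂ) + u * I‖ ≤ condQ q * (2 * T + 2) :=
      mul_le_mul_of_nonneg_left hnorm hQ0.le
    have : (2 : ℝ) ≤ q * T := by nlinarith
    rw [hY₂]; linarith
  have hY0 : 1 ≤ Y₂ := by
    have : 0 ≤ condQ q * ‖(1 / 2 : ℂ) + u * I‖ := by positivity
    rw [hY₂]; linarith
  have hY0' : 0 < Y₂ := by linarith
  -- `log Y₂ ≤ log 2 + log q + log T ≤ 3 log T`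
  have hlogY : Real.log Y₂ ≤ 3 * Real.log T := by
    have h1 : Real.log Y₂ ≤ Real.log (2 * (q * T)) := Real.log_le_log hY0' hY2T
    have h2 : Real.log (2 * (q * T)) = Real.log 2 + Real.log q + Real.log T := by
      rw [Real.log_mul (by norm_num) (by positivity), Real.log_mul hqpos.ne' hT0.ne']; ring
    have h3 : Real.log 2 ≤ Real.log T := Real.log_le_log (by norm_num) (by linarith)
    linarith
  have hlogY0 : 0 ≤ Real.log Y₂ := Real.log_nonneg hY0
  have hf1 : (1 + Real.log Y₂) ^ 4 ≤ (4 * Real.log T) ^ 4 :=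
    pow_le_pow_left₀ (by positivity) (by linarith) 4
  have hf2 : 3 + Real.log Y₂ ≤ 6 * Real.log T := by linarith
  have hA' : ‖afeA K ψ q (1 / 2 + u * I)‖ ^ 2 ≤ (2 * 4 ^ 4 * 6) * CA * ((q : ℝ) * T * Real.log T ^ 5) := by
    refine hAu.trans ?_
    calc CA * Y₂ * (1 + Real.log Y₂) ^ 4 * (3 + Real.log Y₂)
        ≤ CA * (2 * (q * T)) * (4 * Real.log T) ^ 4 * (6 * Real.log T) := by gcongr
      _ = (2 * 4 ^ 4 * 6) * CA * ((q : ℝ) * T * Real.log T ^ 5) := by ring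
  -- `|L|² ≤ 8|A|² + 2M²`
  have hL0 : 0 ≤ ‖classGroupLFunction K ψ (1 / 2 + u * I)‖ := norm_nonneg _
  have hA0 : 0 ≤ ‖afeA K ψ q (1 / 2 + u * I)‖ := norm_nonneg _
  have hLle : ‖classGroupLFunction K ψ (1 / 2 + u * I)‖ ≤ 2 * ‖afeA K ψ q (1 / 2 + u * I)‖ + M := by
    linarith
  have hsq : ‖classGroupLFunction K ψ (1 / 2 + u * I)‖ ^ 2 ≤
      8 * ‖afeA K ψ q (1 / 2 + u * I)‖ ^ 2 + 2 * M ^ 2 := by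
    calc ‖classGroupLFunction K ψ (1 / 2 + u * I)‖ ^ 2 ≤ (2 * ‖afeA K ψ q (1 / 2 + u * I)‖ + M) ^ 2 :=
          pow_le_pow_left₀ hL0 hLle 2
      _ ≤ 8 * ‖afeA K ψ q (1 / 2 + u * I)‖ ^ 2 + 2 * M ^ 2 := by
          nlinarith [sq_nonneg (2 * ‖afeA K ψ q (1 / 2 + u * I)‖ - M)]
  have hbase : (1 : ℝ) ≤ (q : ℝ) * T * Real.log T ^ 5 := by
    have h1 : (1 : ℝ) ≤ (q : ℝ) * T := by nlinarith
    have h2 : (1 : ℝ) ≤ Real.log T ^ 5 := one_le_pow₀ hlogT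
    nlinarith
  calc ‖classGroupLFunction K ψ (1 / 2 + u * I)‖ ^ 2
      ≤ 8 * ((2 * 4 ^ 4 * 6) * CA * ((q : ℝ) * T * Real.log T ^ 5)) + 2 * M ^ 2 * 1 := by
        linarith [hsq, hA']
    _ ≤ 8 * ((2 * 4 ^ 4 * 6) * CA * ((q : ℝ) * T * Real.log T ^ 5)) +
          2 * M ^ 2 * ((q : ℝ) * T * Real.log T ^ 5) := by gcongr
    _ = (8 * (2 * 4 ^ 4 * 6) * CA + 2 * M ^ 2) * ((q : ℝ) * T * Real.log T ^ 5) := by ring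

/-! ### §5. Cauchy–Schwarz -/

/-- `Σ f g ≤ (Σ f²)^{1/2} (Σ g²)^{1/2}` (Cauchy–Schwarz, private plumbing). [folklore] -/
private theorem sum_mul_le_sqrt_mul_sqrt' {ι : Type*} (s : Finset ι) (f g : ι → ℝ) :
    ∑ i ∈ s, f i * g i ≤ Real.sqrt (∑ i ∈ s, f i ^ 2) * Real.sqrt (∑ i ∈ s, g i ^ 2) := by
  rw [← Real.sqrt_mul (Finset.sum_nonneg fun i _ => sq_nonneg (f i))]
  exact (le_abs_self _).trans (Real.abs_le_sqrt (Finset.sum_mul_sq_le_sq_mul_sq s f g))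

/-! ### §6. Proposition 9.1 with arbitrary companions above the floor -/

set_option maxHeartbeats 400000 in
/-- **CI PROPOSITION 9.1 (9.7) WITH ARBITRARY COMPANIONS ABOVE THE FLOOR, FROM PROPOSITION 6.4.** For
`q` odd `> 4`, `χ` the real primitive character mod `q`, `K = ℚ(√−q)`, `ψ ∈ Ĉℓ(K)`, `1`-spaced
`S ⊂ (T, 2T]` with every point `≥ q^65 + 2q + 2`, `q^65 ≤ T`, `e^{(log q)²} ≤ T`, and an ARBITRARY
companion map `t′ : ℝ → ℝ`: `E(T) ≤ C·(T(log q)^6 + Tℒ(T)^{1/2}(log T)²(log q)^{5/2})`.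
Close companions: `prop91_floor_close_of_proposition64`; far companions above `q^65 + q + 1`: the
maximiser trick with `F′ = 𝟙_{≥ q^65+q}|L|²` and the floor mean squares at the levels
`max(T/2, q^65)`, `T`, `2T`; far companions below `q^65 + q + 1`: convexity at distance `> q`
(then `log T ≤ 66 log q`); remote companions: `norm_sq_le_sq_dist_of_remote`.
[cite: ConreyIwaniec2002, Proposition 9.1 (9.7)] -/
theorem prop91_floor_of_proposition64 (h64 : conreyIwaniec2002_proposition64) :
    ∃ C : ℝ, 0 < C ∧
    ∀ (q : ℕ) [NeZero q], 4 < q → Odd q → ∀ χ : DirichletCharacter ℂ q,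
      χ.IsPrimitive → χ.IsQuadratic → χ.Odd →
        ∀ (K : Type) [Field K] [NumberField K],
          Module.finrank ℚ K = 2 → NumberField.discr K = -(q : ℤ) →
            ∀ (ψ : ClassGroup (𝓞 K) →* ℂˣ) (T : ℝ) (S : Finset ℝ) (t' : ℝ → ℝ),
              (q : ℝ) ^ (65 : ℕ) ≤ T → Real.exp (Real.log q ^ (2 : ℕ)) ≤ T → IsDyadicPointSet S T →
                (∀ t ∈ S, (q : ℝ) ^ (65 : ℕ) + 2 * q + 2 ≤ t) →
                defectE K ψ q S t' ≤
                  C * (T * Real.log q ^ (6 : ℕ) +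
                    T * Real.sqrt (calL χ T) * Real.log T ^ (2 : ℕ) * Real.log q ^ ((5 : ℝ) / 2)) := by
  obtain ⟨Ccl, hCcl, hclose⟩ := prop91_floor_close_of_proposition64 h64
  obtain ⟨CL, hCL, hL⟩ := sum_norm_classGroupLFunction_sq_floor h64
  obtain ⟨C₂, hC₂, hM⟩ := sum_norm_shortInvSum_sq_le
  obtain ⟨Kc, hKc, hrem⟩ := norm_sq_le_sq_dist_of_remote
  obtain ⟨Kv, hKv, hconv⟩ := norm_sq_classGroupLFunction_le_conv
  set CG : ℝ := 13 * Real.pi * (132 * CL) with hCG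
  have hCG0 : 0 < CG := by positivity
  set CV : ℝ := 8 * 66 ^ 5 * Kv with hCV
  have hCV0 : 0 < CV := by positivity
  refine ⟨Ccl + 2 * Real.sqrt (CL * C₂) + Real.sqrt (CG * C₂) + Real.sqrt (CV * C₂) +
      Real.sqrt (2 * Kc * C₂) + 5, by positivity,
    fun q _ hq hodd χ hprim hquad hoddχ K _ _ h2 hdisc ψ T S t' hT hexpT hS hfloor2 => ?_⟩
  classical
  -- numerics
  have hq0 : 0 < q := by omega
  have hq5 : (5 : ℝ) ≤ q := by exact_mod_cast hq
  have hq1 : (1 : ℝ) ≤ q := by linarith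
  have hqpos : (0 : ℝ) < q := by linarith
  obtain ⟨hℓ1, -, hLT1, hℓle, hq41, -, hT3, hQT, -, -, -, hqT⟩ := prop81_numerics65 hq hT
  have hT0 : 0 < T := by linarith
  have h625 : (5 : ℝ) ^ (4 : ℕ) ≤ (q : ℝ) ^ (4 : ℕ) := pow_le_pow_left₀ (by norm_num) hq5 4
  have hq4cast : ((q ^ 4 : ℕ) : ℝ) = (q : ℝ) ^ (4 : ℕ) := by push_cast; ring
  have hT4 : (626 : ℝ) ≤ T := by norm_num at h625; linarith
  have hq4T : (q : ℝ) ^ (4 : ℕ) ≤ T := by linarith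
  have hT2 : (2 : ℝ) ≤ T := by linarith
  set F : ℝ := (q : ℝ) ^ (65 : ℕ) with hF
  have hF0 : 0 < F := by positivity
  have hfloor1 : ∀ t ∈ S, F + q ≤ t := fun t ht => by linarith [hfloor2 t ht]
  set ℓ : ℝ := Real.log q with hℓ
  set LT : ℝ := Real.log T with hLT
  set cLT : ℝ := calL χ T with hcLT
  have hℓ0 : 0 ≤ ℓ := by linarith
  have hcLT0 : 0 ≤ cLT := calL_nonneg χ (by linarith)
  set X : ℝ := T * ℓ ^ (7 : ℕ) + T * cLT * LT ^ (4 : ℕ) with hX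
  set Y : ℝ := T * ℓ ^ (6 : ℕ) + T * Real.sqrt cLT * LT ^ (2 : ℕ) * ℓ ^ ((5 : ℝ) / 2) with hY
  have hX0 : 0 ≤ X := by positivity
  have hY0 : 0 ≤ Y := by positivity
  have hTX : T ≤ X := by
    have h7 : (1 : ℝ) ≤ ℓ ^ (7 : ℕ) := one_le_pow₀ hℓ1
    have h8 : T ≤ T * ℓ ^ (7 : ℕ) := le_mul_of_one_le_right hT0.le h7
    have : 0 ≤ T * cLT * LT ^ (4 : ℕ) := by positivity
    rw [hX]; linarith
  have hTY : T ≤ Y := by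
    have h6 : (1 : ℝ) ≤ ℓ ^ (6 : ℕ) := one_le_pow₀ hℓ1
    have h8 : T ≤ T * ℓ ^ (6 : ℕ) := le_mul_of_one_le_right hT0.le h6
    have : 0 ≤ T * Real.sqrt cLT * LT ^ (2 : ℕ) * ℓ ^ ((5 : ℝ) / 2) := by positivity
    rw [hY]; linarith
  -- the points
  have hmem : ∀ t ∈ S, |t| ≤ 2 * T := by
    intro t ht
    have h := hS.mem_bounds ht
    rw [abs_of_pos (by linarith [h.1])]
    exact h.2
  have hsep : ∀ t ∈ S, ∀ u ∈ S, t ≠ u → (1 : ℝ) ≤ |t - u| := fun t ht u hu h => hS.2 t ht u hu h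
  have hcard : (S.card : ℝ) ≤ 2 * T := (hS.isPointSet hT2).card_le' (by linarith)
  -- split `S` by the distance of the companion: close / far (≤ T/4) / remote
  set Sc := S.filter (fun t => |t' t - t| ≤ 1) with hSc
  set Sn := S.filter (fun t => ¬ |t' t - t| ≤ 1) with hSn
  set Sf := Sn.filter (fun t => |t' t - t| ≤ T / 4) with hSf
  set Sr := Sn.filter (fun t => ¬ |t' t - t| ≤ T / 4) with hSr
  have hsplit : defectE K ψ q S t' = defectE K ψ q Sc t' + defectE K ψ q Sf t' + defectE K ψ q Sr t' := by
    unfold defectE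
    rw [← Finset.sum_filter_add_sum_filter_not S (fun t => |t' t - t| ≤ 1),
      ← Finset.sum_filter_add_sum_filter_not (S.filter fun t => ¬ |t' t - t| ≤ 1) (fun t => |t' t - t| ≤ T / 4)]
    ring
  have hScS : Sc ⊆ S := Finset.filter_subset _ _
  have hSnS : Sn ⊆ S := Finset.filter_subset _ _
  have hSfS : Sf ⊆ S := (Finset.filter_subset _ _).trans hSnS
  have hSrS : Sr ⊆ S := (Finset.filter_subset _ _).trans hSnS
  have hfar : ∀ t ∈ Sf, 1 < |t' t - t| ∧ |t' t - t| ≤ T / 4 := fun t ht =>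
    ⟨not_le.mp (Finset.mem_filter.1 (Finset.mem_filter.1 ht).1).2, (Finset.mem_filter.1 ht).2⟩
  have hremote : ∀ t ∈ Sr, T / 4 < |t' t - t| := fun t ht => not_le.mp (Finset.mem_filter.1 ht).2
  -- (1) close companions
  have hEc : defectE K ψ q Sc t' ≤ Ccl * Y :=
    hclose q hq hodd χ hprim hquad hoddχ K h2 hdisc ψ T Sc t' hT hexpT (hS.subset hScS)
      (fun t ht => hfloor1 t (hScS ht)) (fun t ht => (Finset.mem_filter.1 ht).2)
  -- the mean squares at hand
  set Lf : ℝ → ℂ := fun v => classGroupLFunction K ψ (1 / 2 + v * I) with hLf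
  set Mf : ℝ → ℂ := fun v => shortInvSum K ψ q (1 / 2 + v * I) with hMf
  have hD : ∑ t ∈ S, ‖Lf t‖ ^ 2 ≤ CL * (T * ℓ ^ (7 : ℕ) + T * cLT * LT ^ (4 : ℕ)) :=
    hL q hq hodd χ hprim hquad hoddχ K h2 hdisc ψ T S hT hS hfloor1
  have hSM : ∑ t ∈ S, ‖Mf t‖ ^ 2 ≤ C₂ * (T * ℓ ^ (5 : ℕ)) :=
    hM q hq hodd χ hprim hquad hoddχ K h2 hdisc ψ T S hq4T hS
  have hSMsub : ∀ U : Finset ℝ, U ⊆ S → ∑ t ∈ U, ‖Mf t‖ ^ 2 ≤ C₂ * (T * ℓ ^ (5 : ℕ)) := fun U hU =>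
    (Finset.sum_le_sum_of_subset_of_nonneg hU fun _ _ _ => by positivity).trans hSM
  -- `Σ_U |L(s)||M(s)| ≤ √(C_L C₂) Y` for any `U ⊆ S`
  have hLM : ∀ U : Finset ℝ, U ⊆ S → ∑ t ∈ U, ‖Lf t‖ * ‖Mf t‖ ≤ Real.sqrt (CL * C₂) * Y := by
    intro U hU
    calc ∑ t ∈ U, ‖Lf t‖ * ‖Mf t‖ ≤ ∑ t ∈ S, ‖Lf t‖ * ‖Mf t‖ :=
          Finset.sum_le_sum_of_subset_of_nonneg hU fun _ _ _ => by positivity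
      _ ≤ Real.sqrt (∑ t ∈ S, ‖Lf t‖ ^ 2) * Real.sqrt (∑ t ∈ S, ‖Mf t‖ ^ 2) :=
          sum_mul_le_sqrt_mul_sqrt' S _ _
      _ ≤ Real.sqrt (CL * C₂) * Y := diagonal_term_le hCL hC₂ hT0.le hℓ0 hcLT0 hD hSM
  -- (2) far companions, pointwise
  have hEf : defectE K ψ q Sf t' ≤
      ∑ t ∈ Sf, (‖Lf t‖ * ‖Mf t‖ + ‖Lf (t' t)‖ * ‖Mf t‖ / |t' t - t| + 2) := by
    unfold defectE
    exact Finset.sum_le_sum fun t ht => far_pointwise K ψ hq0 (hfar t ht).1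
  rw [Finset.sum_add_distrib, Finset.sum_add_distrib, Finset.sum_const, nsmul_eq_mul] at hEf
  -- (2a) `Σ_{far} |L(s)||M(s)|`
  have h2a : ∑ t ∈ Sf, ‖Lf t‖ * ‖Mf t‖ ≤ Real.sqrt (CL * C₂) * Y := hLM Sf hSfS
  -- (2b) the far-companion sum, split at the height `q^65 + q + 1` of the companion
  set c₁ : ℝ := F + q + 1 with hc₁
  set Sf₁ := Sf.filter (fun t => c₁ ≤ t' t) with hSf₁
  set Sf₂ := Sf.filter (fun t => ¬ c₁ ≤ t' t) with hSf₂
  have hSf₁S : Sf₁ ⊆ S := (Finset.filter_subset _ _).trans hSfS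
  have hSf₂S : Sf₂ ⊆ S := (Finset.filter_subset _ _).trans hSfS
  have hSf₁f : Sf₁ ⊆ Sf := Finset.filter_subset _ _
  have hSf₂f : Sf₂ ⊆ Sf := Finset.filter_subset _ _
  have hsplit2 : ∑ t ∈ Sf, ‖Lf (t' t)‖ * ‖Mf t‖ / |t' t - t| =
      ∑ t ∈ Sf₁, ‖Lf (t' t)‖ * ‖Mf t‖ / |t' t - t| + ∑ t ∈ Sf₂, ‖Lf (t' t)‖ * ‖Mf t‖ / |t' t - t| :=
    (Finset.sum_filter_add_sum_filter_not Sf _ _).symm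
  -- Cauchy–Schwarz on each piece
  have hCS : ∀ U : Finset ℝ, U ⊆ S → ∑ t ∈ U, ‖Lf (t' t)‖ * ‖Mf t‖ / |t' t - t| ≤
      Real.sqrt (∑ t ∈ U, ‖Lf (t' t)‖ ^ 2 / (t' t - t) ^ 2) * Real.sqrt (∑ t ∈ U, ‖Mf t‖ ^ 2) := by
    intro U hU
    calc ∑ t ∈ U, ‖Lf (t' t)‖ * ‖Mf t‖ / |t' t - t|
        = ∑ t ∈ U, (‖Lf (t' t)‖ / |t' t - t|) * ‖Mf t‖ := by
          refine Finset.sum_congr rfl fun t _ => ?_; ring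
      _ ≤ Real.sqrt (∑ t ∈ U, (‖Lf (t' t)‖ / |t' t - t|) ^ 2) * Real.sqrt (∑ t ∈ U, ‖Mf t‖ ^ 2) :=
          sum_mul_le_sqrt_mul_sqrt' U _ _
      _ = Real.sqrt (∑ t ∈ U, ‖Lf (t' t)‖ ^ 2 / (t' t - t) ^ 2) * Real.sqrt (∑ t ∈ U, ‖Mf t‖ ^ 2) := by
          congr 2
          refine Finset.sum_congr rfl fun t _ => ?_
          rw [div_pow, sq_abs]
  -- (2b1) companions above `q^65 + q + 1`: the maximiser trick with the truncated `F′`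
  set Fc : ℝ → ℝ := fun v => if F + q ≤ v then ‖Lf v‖ ^ 2 else 0 with hFc
  have hFc0 : ∀ v, 0 ≤ Fc v := fun v => by
    simp only [hFc]; split_ifs <;> positivity
  have hgc : Continuous fun v : ℝ => ‖Lf v‖ ^ 2 := continuous_norm_sq_classGroupLFunction_line ψ
  choose u hu1 hu2 humax using fun k : ℤ =>
    exists_max_trunc (fun v : ℝ => ‖Lf v‖ ^ 2) hgc (fun v => by positivity) (F + q) k
  have hFmax : ∀ (k : ℤ) (v : ℝ), (k : ℝ) ≤ v → v ≤ k + 1 → Fc v ≤ Fc (u k) :=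
    fun k v hv1 hv2 => humax k v hv1 hv2
  set 𝒦 : Finset ℤ := Sf₁.image (fun t => ⌊t' t⌋) with h𝒦
  have hfar1 : ∀ t ∈ Sf₁, 1 < |t' t - t| := fun t ht => (hfar t (hSf₁f ht)).1
  have hG₁ : ∑ t ∈ Sf₁, Fc (t' t) / (t' t - t) ^ 2 ≤ 13 * Real.pi * ∑ k ∈ 𝒦, Fc (u k) :=
    far_sum_le_sup_sum (by positivity) hSf₁S hmem hsep t' hfar1 Fc hFc0 u hFmax
  have hG₁' : ∑ t ∈ Sf₁, ‖Lf (t' t)‖ ^ 2 / (t' t - t) ^ 2 = ∑ t ∈ Sf₁, Fc (t' t) / (t' t - t) ^ 2 := by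
    refine Finset.sum_congr rfl fun t ht => ?_
    have hc : F + q ≤ t' t := by
      have := (Finset.mem_filter.1 ht).2; rw [hc₁] at this; linarith
    simp only [hFc, if_pos hc]
  have hrange : ∀ k ∈ 𝒦, T / 2 < u k ∧ u k ≤ 4 * T := by
    intro k hk
    obtain ⟨t, ht, htk⟩ := Finset.mem_image.mp hk
    have htS := hS.mem_bounds (hSf₁S ht)
    have hc := abs_le.1 (hfar t (hSf₁f ht)).2
    have h1 : (k : ℝ) ≤ t' t := by rw [← htk]; exact Int.floor_le _
    have h2' : t' t < k + 1 := by rw [← htk]; exact Int.lt_floor_add_one _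
    have hk1 := hu1 k
    have hk2 := hu2 k
    constructor
    · linarith [htS.1, hc.1]
    · linarith [htS.2, hc.2]
  -- the windows: sums of `F′` over dyadic sets only see points above `q^65 + q`
  have hwin : ∀ (T₁ : ℝ) (U : Finset ℝ), IsDyadicPointSet U T₁ → F ≤ T₁ → T₁ ≤ 2 * T →
      (∀ x ∈ U, F + q ≤ x → T₁ < x) →
      ∑ x ∈ U, Fc x ≤ CL * (T₁ * ℓ ^ (7 : ℕ) + T₁ * calL χ T₁ * Real.log T₁ ^ (4 : ℕ)) := by
    intro T₁ U hU hFT₁ hT₁ _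
    rw [hFc, ← Finset.sum_filter]
    have hU' : IsDyadicPointSet (U.filter fun x => F + q ≤ x) T₁ := hU.subset (Finset.filter_subset _ _)
    exact hL q hq hodd χ hprim hquad hoddχ K h2 hdisc ψ T₁ (U.filter fun x => F + q ≤ x) hFT₁ hU'
      (fun x hx => (Finset.mem_filter.1 hx).2)
  -- window at `T/2`, re-levelled at `T₀ = max(T/2, q^65)`
  set T₀ : ℝ := max (T / 2) F with hT₀
  have hT₀T : T₀ ≤ T := max_le (by linarith) hT
  have hT₀F : F ≤ T₀ := le_max_right _ _
  have hT₀h : T / 2 ≤ T₀ := le_max_left _ _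
  have hT₀1 : 1 ≤ T₀ := by linarith
  have hXle : ∀ T₁ : ℝ, 1 ≤ T₁ → T₁ ≤ T →
      CL * (T₁ * ℓ ^ (7 : ℕ) + T₁ * calL χ T₁ * Real.log T₁ ^ (4 : ℕ)) ≤ CL * X := by
    intro T₁ h1 h2
    refine mul_le_mul_of_nonneg_left ?_ hCL.le
    have hc1 : calL χ T₁ ≤ cLT := calL_mono χ (by linarith) h2
    have hc0 : 0 ≤ calL χ T₁ := calL_nonneg χ h1
    have hl0 : 0 ≤ Real.log T₁ := Real.log_nonneg h1
    have hl1 : Real.log T₁ ≤ LT := Real.log_le_log (by linarith) h2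
    have hl4 : Real.log T₁ ^ (4 : ℕ) ≤ LT ^ (4 : ℕ) := pow_le_pow_left₀ hl0 hl1 4
    have hℓ7 : 0 ≤ ℓ ^ (7 : ℕ) := by positivity
    rw [hX]
    apply add_le_add
    · exact mul_le_mul_of_nonneg_right h2 hℓ7
    · gcongr
  have hW₁ : ∀ U : Finset ℝ, IsDyadicPointSet U (T / 2) → ∑ x ∈ U, Fc x ≤ CL * X := by
    intro U hU
    -- the points of `U` with `F + q ≤ x` form a dyadic set at level `T₀`
    rw [hFc, ← Finset.sum_filter]
    have hU' : IsDyadicPointSet (U.filter fun x => F + q ≤ x) T₀ := by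
      refine ⟨fun x hx => ?_, fun x hx y hy hxy =>
        hU.2 x (Finset.filter_subset _ _ hx) y (Finset.filter_subset _ _ hy) hxy⟩
      have hxU := hU.1 x (Finset.filter_subset _ _ hx)
      have hxF := (Finset.mem_filter.1 hx).2
      constructor
      · rcases le_total (T / 2) F with h | h
        · rw [hT₀, max_eq_right h]; linarith
        · rw [hT₀, max_eq_left h]; exact hxU.1
      · linarith [hxU.2]
    exact (hL q hq hodd χ hprim hquad hoddχ K h2 hdisc ψ T₀ (U.filter fun x => F + q ≤ x) hT₀F hU'
      (fun x hx => (Finset.mem_filter.1 hx).2)).trans (hXle T₀ hT₀1 hT₀T)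
  have hW₂ : ∀ U : Finset ℝ, IsDyadicPointSet U T → ∑ x ∈ U, Fc x ≤ CL * X := by
    intro U hU
    rw [hFc, ← Finset.sum_filter]
    exact (hL q hq hodd χ hprim hquad hoddχ K h2 hdisc ψ T (U.filter fun x => F + q ≤ x) hT
      (hU.subset (Finset.filter_subset _ _)) (fun x hx => (Finset.mem_filter.1 hx).2)).trans
      (hXle T (by linarith) le_rfl)
  have hW₃ : ∀ U : Finset ℝ, IsDyadicPointSet U (2 * T) → ∑ x ∈ U, Fc x ≤ 64 * (CL * X) := by
    intro U hU
    rw [hFc, ← Finset.sum_filter]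
    have h := hL q hq hodd χ hprim hquad hoddχ K h2 hdisc ψ (2 * T) (U.filter fun x => F + q ≤ x)
      (by linarith) (hU.subset (Finset.filter_subset _ _)) (fun x hx => (Finset.mem_filter.1 hx).2)
    refine h.trans ?_
    have hc1 : calL χ (2 * T) ≤ 2 * cLT := calL_two_mul_le χ hT2
    have hc0 : 0 ≤ calL χ (2 * T) := calL_nonneg χ (by linarith)
    have hl2 : Real.log 2 ≤ LT := Real.log_le_log (by norm_num) hT2
    have hlog2T : Real.log (2 * T) = Real.log 2 + LT := by
      rw [hLT, Real.log_mul (by norm_num) hT0.ne']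
    have hl1 : Real.log (2 * T) ≤ 2 * LT := by rw [hlog2T]; linarith
    have hl0 : 0 ≤ Real.log (2 * T) := Real.log_nonneg (by linarith)
    have hl4 : Real.log (2 * T) ^ (4 : ℕ) ≤ (2 * LT) ^ (4 : ℕ) := pow_le_pow_left₀ hl0 hl1 4
    have hLT0 : 0 ≤ LT := by linarith
    have : 2 * T * ℓ ^ (7 : ℕ) + 2 * T * calL χ (2 * T) * Real.log (2 * T) ^ (4 : ℕ) ≤ 64 * X := by
      rw [hX]
      have e : (2 * LT) ^ (4 : ℕ) = 16 * LT ^ (4 : ℕ) := by ring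
      rw [e] at hl4
      have h1 : 2 * T * calL χ (2 * T) * Real.log (2 * T) ^ (4 : ℕ) ≤
          2 * T * (2 * cLT) * (16 * LT ^ (4 : ℕ)) := by gcongr
      have h0 : 0 ≤ T * ℓ ^ (7 : ℕ) := by positivity
      have e1 : 2 * T * (2 * cLT) * (16 * LT ^ (4 : ℕ)) = 64 * (T * cLT * LT ^ (4 : ℕ)) := by ring
      rw [e1] at h1
      linarith
    calc CL * (2 * T * ℓ ^ (7 : ℕ) + 2 * T * calL χ (2 * T) * Real.log (2 * T) ^ (4 : ℕ))
        ≤ CL * (64 * X) := mul_le_mul_of_nonneg_left this hCL.le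
      _ = 64 * (CL * X) := by ring
  have hsup : ∑ k ∈ 𝒦, Fc (u k) ≤ 2 * (CL * X + CL * X + 64 * (CL * X)) :=
    sum_sup_le Fc u (fun k => ⟨hu1 k, hu2 k⟩) 𝒦 hrange hW₁ hW₂ hW₃
  have hGX₁ : ∑ t ∈ Sf₁, ‖Lf (t' t)‖ ^ 2 / (t' t - t) ^ 2 ≤ CG * (T * ℓ ^ (7 : ℕ) + T * cLT * LT ^ (4 : ℕ)) := by
    rw [hG₁']
    refine hG₁.trans ?_
    have : 13 * Real.pi * ∑ k ∈ 𝒦, Fc (u k) ≤ 13 * Real.pi * (2 * (CL * X + CL * X + 64 * (CL * X))) :=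
      mul_le_mul_of_nonneg_left hsup (by positivity)
    refine this.trans (le_of_eq ?_)
    rw [hCG, hX]; ring
  have h2b1 : ∑ t ∈ Sf₁, ‖Lf (t' t)‖ * ‖Mf t‖ / |t' t - t| ≤ Real.sqrt (CG * C₂) * Y :=
    (hCS Sf₁ hSf₁S).trans (diagonal_term_le hCG0 hC₂ hT0.le hℓ0 hcLT0 hGX₁ (hSMsub Sf₁ hSf₁S))
  -- (2b2) companions below `q^65 + q + 1`: convexity at distance `> q`
  have hGX₂ : ∑ t ∈ Sf₂, ‖Lf (t' t)‖ ^ 2 / (t' t - t) ^ 2 ≤ CV * (T * ℓ ^ (7 : ℕ) + T * cLT * LT ^ (4 : ℕ)) := by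
    rcases Sf₂.eq_empty_or_nonempty with h0 | ⟨t₀, ht₀⟩
    · rw [h0, Finset.sum_empty]; positivity
    -- the regime: `T < 2q^65`, so `log T ≤ 66 log q`
    have ht₀c : t' t₀ < c₁ := not_le.mp (Finset.mem_filter.1 ht₀).2
    have ht₀S := hS.mem_bounds (hSf₂S ht₀)
    have ht₀far := abs_le.1 (hfar t₀ (hSf₂f ht₀)).2
    have hT2F : T < 2 * F := by
      have : 3 * T / 4 < c₁ := by linarith [ht₀S.1, ht₀far.1]
      rw [hc₁] at this
      have hq65 : 4 * (q : ℝ) + 4 ≤ 2 * F := by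
        have : (q : ℝ) * 5 ≤ F := by
          calc (q : ℝ) * 5 ≤ (q : ℝ) * q := by gcongr
            _ = (q : ℝ) ^ 2 := by ring
            _ ≤ F := pow_le_pow_right₀ hq1 (by norm_num)
        linarith
      linarith
    have hlogT66 : LT ≤ 66 * ℓ := by
      have h1 : LT ≤ Real.log (2 * F) := Real.log_le_log hT0 hT2F.le
      have h2' : Real.log (2 * F) = Real.log 2 + 65 * ℓ := by
        rw [Real.log_mul (by norm_num) hF0.ne', hF, Real.log_pow]; push_cast; ring
      have h3 : Real.log 2 ≤ ℓ := Real.log_le_log (by norm_num) (by linarith)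
      linarith
    have hLT0 : 0 ≤ LT := by linarith
    -- pointwise convexity bound for the companions of `Sf₂`
    have hptv : ∀ t ∈ Sf₂, ‖Lf (t' t)‖ ^ 2 ≤ Kv * ((q : ℝ) * T * LT ^ 5) := by
      intro t ht
      have htS := hS.mem_bounds (hSf₂S ht)
      have hfc := abs_le.1 (hfar t (hSf₂f ht)).2
      have ht'lo : 3 * T / 4 < t' t := by linarith [htS.1, hfc.1]
      have ht'hi : t' t ≤ 2 * T + 1 := by
        have := not_le.mp (Finset.mem_filter.1 ht).2
        linarith [htS.2, hfc.2]
      have ht'pos : 0 < t' t := by linarith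
      have habs : |t' t| = t' t := abs_of_pos ht'pos
      have hqF : (q : ℝ) + 1 ≤ 3 * T / 4 := by
        have h3 : (125 : ℝ) ≤ (q : ℝ) ^ (3 : ℕ) := by
          have := pow_le_pow_left₀ (by norm_num : (0 : ℝ) ≤ 5) hq5 3
          norm_num at this; exact this
        have hq4 : (q : ℝ) * 125 ≤ (q : ℝ) ^ (4 : ℕ) := by
          calc (q : ℝ) * 125 ≤ (q : ℝ) * (q : ℝ) ^ (3 : ℕ) := by gcongr
            _ = (q : ℝ) ^ (4 : ℕ) := by ring
        linarith
      exact hconv q hq χ hprim hquad hoddχ K h2 hdisc ψ T (t' t) hT3 hqT hQT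
        (by rw [habs]; linarith) (by rw [habs]; linarith) (by rw [habs]; linarith)
    -- the distances: `t − t′ ≥ t − c₁ ≥ q + 1`
    have hdist : ∑ t ∈ Sf₂, ((t - c₁) ^ 2)⁻¹ ≤ 8 / ((q : ℝ) + 1) :=
      sum_inv_sq_sub_le_of_floor Sf₂ (by linarith) (fun t ht => by
        have := hfloor2 t (hSf₂S ht); rw [hc₁]; linarith)
        (fun t ht v hv htv => hsep t (hSf₂S ht) v (hSf₂S hv) htv)
    have hterm : ∀ t ∈ Sf₂, ‖Lf (t' t)‖ ^ 2 / (t' t - t) ^ 2 ≤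
        Kv * ((q : ℝ) * T * LT ^ 5) * ((t - c₁) ^ 2)⁻¹ := by
      intro t ht
      have hlt : t' t < c₁ := not_le.mp (Finset.mem_filter.1 ht).2
      have htc : c₁ + 1 ≤ t := by
        have := hfloor2 t (hSf₂S ht); rw [hc₁]; linarith
      have h1 : (t - c₁) ^ 2 ≤ (t' t - t) ^ 2 := by
        rw [show (t' t - t) ^ 2 = (t - t' t) ^ 2 by ring]
        exact pow_le_pow_left₀ (by linarith) (by linarith) 2
      have hpos : 0 < (t - c₁) ^ 2 := by
        have : 0 < t - c₁ := by linarith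
        positivity
      rw [div_eq_mul_inv]
      exact mul_le_mul (hptv t ht) (inv_anti₀ hpos h1) (inv_nonneg.mpr (sq_nonneg _))
        (mul_nonneg hKv.le (by positivity))
    calc ∑ t ∈ Sf₂, ‖Lf (t' t)‖ ^ 2 / (t' t - t) ^ 2
        ≤ ∑ t ∈ Sf₂, Kv * ((q : ℝ) * T * LT ^ 5) * ((t - c₁) ^ 2)⁻¹ := Finset.sum_le_sum hterm
      _ = Kv * ((q : ℝ) * T * LT ^ 5) * ∑ t ∈ Sf₂, ((t - c₁) ^ 2)⁻¹ := by rw [Finset.mul_sum]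
      _ ≤ Kv * ((q : ℝ) * T * LT ^ 5) * (8 / ((q : ℝ) + 1)) :=
          mul_le_mul_of_nonneg_left hdist (by positivity)
      _ ≤ Kv * ((q : ℝ) * T * LT ^ 5) * (8 / (q : ℝ)) := by
          gcongr
          linarith
      _ = 8 * Kv * (T * LT ^ 5) := by field_simp
      _ ≤ 8 * Kv * (T * (66 * ℓ) ^ 5) := by gcongr
      _ = CV * (T * ℓ ^ 5) := by rw [hCV]; ring
      _ ≤ CV * (T * ℓ ^ (7 : ℕ) + T * cLT * LT ^ (4 : ℕ)) := by
          refine mul_le_mul_of_nonneg_left ?_ hCV0.le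
          have h57 : ℓ ^ 5 ≤ ℓ ^ (7 : ℕ) := pow_le_pow_right₀ hℓ1 (by norm_num)
          have h57T : T * ℓ ^ 5 ≤ T * ℓ ^ (7 : ℕ) := mul_le_mul_of_nonneg_left h57 hT0.le
          have : 0 ≤ T * cLT * LT ^ (4 : ℕ) := by positivity
          linarith
  have h2b2 : ∑ t ∈ Sf₂, ‖Lf (t' t)‖ * ‖Mf t‖ / |t' t - t| ≤ Real.sqrt (CV * C₂) * Y :=
    (hCS Sf₂ hSf₂S).trans (diagonal_term_le hCV0 hC₂ hT0.le hℓ0 hcLT0 hGX₂ (hSMsub Sf₂ hSf₂S))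
  -- (2c) the constant `2` per far point
  have h2c : (2 : ℝ) * (Sf.card : ℝ) ≤ 4 * Y := by
    have : (Sf.card : ℝ) ≤ S.card := by exact_mod_cast Finset.card_le_card hSfS
    linarith
  have hfarY : defectE K ψ q Sf t' ≤
      (Real.sqrt (CL * C₂) + Real.sqrt (CG * C₂) + Real.sqrt (CV * C₂) + 4) * Y := by
    have hexpand : (Real.sqrt (CL * C₂) + Real.sqrt (CG * C₂) + Real.sqrt (CV * C₂) + 4) * Y =
        Real.sqrt (CL * C₂) * Y + (Real.sqrt (CG * C₂) * Y + Real.sqrt (CV * C₂) * Y) + 4 * Y := by ring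
    rw [hexpand]
    have hmid : ∑ t ∈ Sf, ‖Lf (t' t)‖ * ‖Mf t‖ / |t' t - t| ≤
        Real.sqrt (CG * C₂) * Y + Real.sqrt (CV * C₂) * Y := by
      rw [hsplit2]; exact add_le_add h2b1 h2b2
    have hcs : (Sf.card : ℝ) * 2 = 2 * (Sf.card : ℝ) := by ring
    linarith [hEf, h2a, hmid, h2c]
  -- (3) remote companions, pointwise (the tree's convexity bound)
  have hptw : ∀ t ∈ Sr,
      ‖dividedDifference (classGroupLFunction K ψ) (1 / 2 + t * I) (1 / 2 + t' t * I) *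
            starRingEnd ℂ (shortInvSum K ψ q (1 / 2 + t * I)) -
          xQuot q (1 / 2 + t * I) (1 / 2 + t' t * I)‖ ≤
        4 / T * (‖Lf t‖ * ‖Mf t‖) + ‖Lf (t' t)‖ / |t' t - t| * ‖Mf t‖ + 8 / T := by
    intro t ht
    have hd := hremote t ht
    have hne : t' t ≠ t := by
      intro e; rw [e, sub_self, abs_zero] at hd; linarith
    have hd0 : 0 < |t' t - t| := by linarith
    have hinv : 1 / |t' t - t| ≤ 4 / T := by
      rw [div_le_div_iff₀ hd0 hT0]; linarith
    have hℓ' := norm_dividedDifference_half_le (classGroupLFunction K ψ) hne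
    have hx := norm_xQuot_le_two_div hq0 hne
    have hM0 : 0 ≤ ‖Mf t‖ := norm_nonneg _
    have hL0 : 0 ≤ ‖Lf t‖ := norm_nonneg _
    have hL0' : 0 ≤ ‖Lf (t' t)‖ := norm_nonneg _
    calc ‖dividedDifference (classGroupLFunction K ψ) (1 / 2 + t * I) (1 / 2 + t' t * I) *
              starRingEnd ℂ (Mf t) - xQuot q (1 / 2 + t * I) (1 / 2 + t' t * I)‖
        ≤ ‖dividedDifference (classGroupLFunction K ψ) (1 / 2 + t * I) (1 / 2 + t' t * I) *
              starRingEnd ℂ (Mf t)‖ + ‖xQuot q (1 / 2 + t * I) (1 / 2 + t' t * I)‖ := norm_sub_le _ _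
      _ = ‖dividedDifference (classGroupLFunction K ψ) (1 / 2 + t * I) (1 / 2 + t' t * I)‖ * ‖Mf t‖ +
            ‖xQuot q (1 / 2 + t * I) (1 / 2 + t' t * I)‖ := by rw [norm_mul, RCLike.norm_conj]
      _ ≤ (‖Lf t‖ + ‖Lf (t' t)‖) / |t' t - t| * ‖Mf t‖ + 2 / |t' t - t| := by gcongr
      _ = (1 / |t' t - t|) * (‖Lf t‖ * ‖Mf t‖) + ‖Lf (t' t)‖ / |t' t - t| * ‖Mf t‖ +
            2 * (1 / |t' t - t|) := by ring
      _ ≤ 4 / T * (‖Lf t‖ * ‖Mf t‖) + ‖Lf (t' t)‖ / |t' t - t| * ‖Mf t‖ + 2 * (4 / T) := by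
          gcongr
      _ = 4 / T * (‖Lf t‖ * ‖Mf t‖) + ‖Lf (t' t)‖ / |t' t - t| * ‖Mf t‖ + 8 / T := by ring
  have hEr : defectE K ψ q Sr t' ≤
      ∑ t ∈ Sr, (4 / T * (‖Lf t‖ * ‖Mf t‖) + ‖Lf (t' t)‖ / |t' t - t| * ‖Mf t‖ + 8 / T) := by
    unfold defectE
    exact Finset.sum_le_sum hptw
  rw [Finset.sum_add_distrib, Finset.sum_add_distrib, Finset.sum_const, nsmul_eq_mul,
    ← Finset.mul_sum] at hEr
  have h3a : 4 / T * ∑ t ∈ Sr, ‖Lf t‖ * ‖Mf t‖ ≤ Real.sqrt (CL * C₂) * Y := by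
    have h1 := hLM Sr hSrS
    have h4T : 4 / T ≤ 1 := by rw [div_le_one hT0]; linarith
    have h0 : 0 ≤ ∑ t ∈ Sr, ‖Lf t‖ * ‖Mf t‖ := Finset.sum_nonneg fun _ _ => by positivity
    calc 4 / T * ∑ t ∈ Sr, ‖Lf t‖ * ‖Mf t‖ ≤ 1 * ∑ t ∈ Sr, ‖Lf t‖ * ‖Mf t‖ :=
          mul_le_mul_of_nonneg_right h4T h0
      _ ≤ Real.sqrt (CL * C₂) * Y := by rw [one_mul]; exact h1
  have hGr : ∑ t ∈ Sr, ‖Lf (t' t)‖ ^ 2 / (t' t - t) ^ 2 ≤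
      2 * Kc * (T * ℓ ^ (7 : ℕ) + T * cLT * LT ^ (4 : ℕ)) := by
    have hpt : ∀ t ∈ Sr, ‖Lf (t' t)‖ ^ 2 / (t' t - t) ^ 2 ≤ Kc := by
      intro t ht
      have hd := hremote t ht
      have htS := hS.mem_bounds (hSrS ht)
      have h := hrem q hq χ hprim hquad hoddχ K h2 hdisc ψ T t (t' t) hq4T htS.1 htS.2 hd
      have hd0 : 0 < |t' t - t| := by linarith
      have hd2 : 0 < (t' t - t) ^ 2 := by rw [← sq_abs]; positivity
      rw [div_le_iff₀ hd2]
      exact h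
    have hcardr : (Sr.card : ℝ) ≤ 2 * T := by
      have : (Sr.card : ℝ) ≤ S.card := by exact_mod_cast Finset.card_le_card hSrS
      linarith
    calc ∑ t ∈ Sr, ‖Lf (t' t)‖ ^ 2 / (t' t - t) ^ 2 ≤ ∑ t ∈ Sr, Kc := Finset.sum_le_sum hpt
      _ = Sr.card * Kc := by rw [Finset.sum_const, nsmul_eq_mul]
      _ ≤ 2 * T * Kc := mul_le_mul_of_nonneg_right hcardr hKc.le
      _ = 2 * Kc * T := by ring
      _ ≤ 2 * Kc * X := mul_le_mul_of_nonneg_left hTX (by positivity)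
      _ = 2 * Kc * (T * ℓ ^ (7 : ℕ) + T * cLT * LT ^ (4 : ℕ)) := by rw [hX]
  have h3b : ∑ t ∈ Sr, ‖Lf (t' t)‖ / |t' t - t| * ‖Mf t‖ ≤ Real.sqrt (2 * Kc * C₂) * Y := by
    have hK2 : 0 < 2 * Kc := by positivity
    have e : ∑ t ∈ Sr, ‖Lf (t' t)‖ / |t' t - t| * ‖Mf t‖ = ∑ t ∈ Sr, ‖Lf (t' t)‖ * ‖Mf t‖ / |t' t - t| := by
      refine Finset.sum_congr rfl fun t _ => ?_; ring
    rw [e]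
    exact (hCS Sr hSrS).trans (diagonal_term_le hK2 hC₂ hT0.le hℓ0 hcLT0 hGr (hSMsub Sr hSrS))
  have h3c : (Sr.card : ℝ) * (8 / T) ≤ Y := by
    have : (Sr.card : ℝ) ≤ S.card := by exact_mod_cast Finset.card_le_card hSrS
    have h16 : (Sr.card : ℝ) * (8 / T) ≤ 16 := by
      rw [mul_div_assoc', div_le_iff₀ hT0]; linarith
    linarith
  have hErY : defectE K ψ q Sr t' ≤ (Real.sqrt (CL * C₂) + Real.sqrt (2 * Kc * C₂) + 1) * Y := by
    have hexpand : (Real.sqrt (CL * C₂) + Real.sqrt (2 * Kc * C₂) + 1) * Y =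
        Real.sqrt (CL * C₂) * Y + Real.sqrt (2 * Kc * C₂) * Y + Y := by ring
    rw [hexpand]
    linarith [hEr, h3a, h3b, h3c]
  -- assemble
  have hcomb : (Ccl + 2 * Real.sqrt (CL * C₂) + Real.sqrt (CG * C₂) + Real.sqrt (CV * C₂) +
      Real.sqrt (2 * Kc * C₂) + 5) * Y =
      Ccl * Y + (Real.sqrt (CL * C₂) + Real.sqrt (CG * C₂) + Real.sqrt (CV * C₂) + 4) * Y +
        (Real.sqrt (CL * C₂) + Real.sqrt (2 * Kc * C₂) + 1) * Y := by ring
  rw [hsplit, hcomb]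
  exact add_le_add (add_le_add hEc hfarY) hErY

end ConreyIwaniec2002

end Literature.NumberTheory.LFunctions

end
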